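import Literature.NumberTheory.DiophantineGeometry.GenEllConfigurationProtection
import HarnessLib

/-!
# [GenEll] Thm. 2.1 (ii) ⇒ (i) for `ℙ¹`: per-configuration protection — the JUNCTION lemma
# "bad polynomial coprime to the configuration" from a root-set description of the bad `x`-set

S. Mochizuki, *Arithmetic elliptic curves in general position*, Math. J. Okayama Univ. 52 (2010)
[cite: MochizukiGenEll2010, Thm 2.1 p.12] (the noncritical Belyi map of a configuration is
noncritical at — avoids — the points of the configuration). Companion of
`GenEllConfigurationProtection` (abc-iut-w5-d075) for the `GenEllTwo` assembly (cell abc-iut, RULING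
#6): there the bad `x`-set of the mechanism `φ_T = β_T ∘ ψ_T ∘ t_c` was handled as a `Finset`; the
W5-F holder (abc-iut-w5-d015, `GenEllDeFibresPolynomial`) delivers it instead as the ROOT SET of one
explicit `g ∈ ℚ[X]` (a resultant), uniformly in every algebraically closed field:
`g(a) = 0 ↔ ∃ r, (a, r) ∈ D_e non-polar ∧ m(t_c(a, r)) = 0`, `m` the polynomial of the bad
`u`-values. This file proves the one implication the persistent spine
(`vojtaIneq_univ_of_persistent(_places)`, hypothesis `hmech`) then needs:

* `isCoprime_of_rootSet_subset` — if every root of `g` (in an algebraically closed `L ⊇ ℚ`) is the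
  `x`-coordinate of a non-polar curve point whose `t_c`-value is a root of `m`, if the `t_c`-values
  over the roots of `q` are roots of `c_T` (`exists_polePoly` (a)), and if `m` is coprime to `c_T`
  (the bad values are not poles of `ψ_T`: they are finite values of `ψ_T⁻¹(β_T⁻¹{0,1,∞})`), then
  `IsCoprime g q`.

Theorems only; classical; nothing here bears on [IUTchIII] Cor. 3.12.
-/

noncomputable section

open Polynomial

namespace Literature.NumberTheory.DiophantineGeometry.GenEll

namespace ConfigurationProtection

/-- **Junction: the bad polynomial is coprime to the configuration.** Let `L ⊇ ℚ` be algebraically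
closed. Suppose every root `a ∈ L` of `g ∈ ℚ[X]` is the `x`-coordinate of a non-polar point `(a, r)`
of `D_e` with `m(t_c(a, r)) = 0` (root-set description of the bad `x`-set, `m` = polynomial of the bad
`u`-values), every non-polar point over a root of `q` has `t_c`-value a root of `c_T` (the pole
polynomial), and `m` is coprime to `c_T`. Then `g` is coprime to `q`: no entry of the configuration is
bad. [cite: MochizukiGenEll2010, Thm 2.1 p.12] -/
theorem isCoprime_of_rootSet_subset {L : Type*} [Field L] [Algebra ℚ L] [IsAlgClosed L] (k : ℕ)
    (c : ℚ) {g q m cT : ℚ[X]}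
    (hg : ∀ a : L, aeval a g = 0 → ∃ r : L, r ^ (2 * k + 1) = a * (1 - a) ∧ r ≠ 0 ∧ 1 - 2 * a ≠ 0 ∧
      aeval (((1 - 2 * a) + algebraMap ℚ L c * r ^ (k + 2)) / (r * (1 - 2 * a))) m = 0)
    (hT : ∀ z : L × L, z.2 ^ (2 * k + 1) = z.1 * (1 - z.1) → z.2 ≠ 0 → 1 - 2 * z.1 ≠ 0 →
      aeval z.1 q = 0 →
        aeval (((1 - 2 * z.1) + algebraMap ℚ L c * z.2 ^ (k + 2)) / (z.2 * (1 - 2 * z.1))) cT = 0)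
    (hmT : IsCoprime m cT) :
    IsCoprime g q := by
  rw [Polynomial.isCoprime_iff_aeval_ne_zero_of_isAlgClosed ℚ L]
  intro a
  by_contra h
  push Not at h
  obtain ⟨hga, hqa⟩ := h
  obtain ⟨r, hcurve, hr, hs, hm⟩ := hg a hga
  have hcT := hT (a, r) hcurve hr hs hqa
  -- `m` and `c_T` have the common root `t_c(a, r)`: contradiction with coprimality
  obtain ⟨u, v, huv⟩ := hmT
  have := congrArg (aeval (((1 - 2 * a) + algebraMap ℚ L c * r ^ (k + 2)) / (r * (1 - 2 * a)))) huv
  rw [map_add, map_mul, map_mul, hm, map_one] at this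
  simp only [mul_zero, zero_add] at this
  rw [hcT, mul_zero] at this
  exact zero_ne_one this

/-- The same junction with the root-set description stated as an `↔` on the root set (the shape of a
resultant computation, `g.rootSet L = {x | ∃ r, …}`), of which only the inclusion `⊆` is used.
[cite: MochizukiGenEll2010, Thm 2.1 p.12] -/
theorem isCoprime_of_rootSet_eq {L : Type*} [Field L] [Algebra ℚ L] [IsAlgClosed L] (k : ℕ)
    (c : ℚ) {g q m cT : ℚ[X]}
    (hg : g.rootSet L = {a : L | ∃ r : L, r ^ (2 * k + 1) = a * (1 - a) ∧ r ≠ 0 ∧ 1 - 2 * a ≠ 0 ∧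
      aeval (((1 - 2 * a) + algebraMap ℚ L c * r ^ (k + 2)) / (r * (1 - 2 * a))) m = 0})
    (hg0 : g ≠ 0)
    (hT : ∀ z : L × L, z.2 ^ (2 * k + 1) = z.1 * (1 - z.1) → z.2 ≠ 0 → 1 - 2 * z.1 ≠ 0 →
      aeval z.1 q = 0 →
        aeval (((1 - 2 * z.1) + algebraMap ℚ L c * z.2 ^ (k + 2)) / (z.2 * (1 - 2 * z.1))) cT = 0)
    (hmT : IsCoprime m cT) :
    IsCoprime g q := by
  refine isCoprime_of_rootSet_subset (L := L) k c (fun a hga => ?_) hT hmT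
  have ha : a ∈ g.rootSet L := by
    rw [Polynomial.mem_rootSet]
    exact ⟨hg0, hga⟩
  rw [hg] at ha
  exact ha

/-! ## The SEPARABLE pole polynomial (input format of the W6⁺ protection theorems) and `hmT` -/

section Separable

variable {L : Type*} [Field L] [Algebra ℚ L] [IsAlgClosure ℚ L]

/-- **The pole polynomial, separable form.** As `exists_polePoly`, with `c_T` moreover MONIC and
SEPARABLE (the product of the DISTINCT minimal polynomials of the `t_c`-values over the roots of `q`)
— the input format `M` of the protection theorems `NoncriticalBelyi.exists_belyi_protecting_roots_of`
(abc-iut-w5-d077) / `exists_belyi_noncritical_protect` (abc-iut-S7), which produce the Belyi pair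
`(P, Q)` of `β_T ∘ ψ_T` with `P, Q, P − Q` nonvanishing at the roots of `M`.
[cite: MochizukiGenEll2010, Thm 2.1 p.12] -/
theorem exists_polePoly_separable (k : ℕ) (c : ℚ) {q : ℚ[X]} (hq : q ≠ 0) :
    ∃ cT : ℚ[X], cT.Monic ∧ cT.Separable ∧
      (∀ z : L × L, z.2 ^ (2 * k + 1) = z.1 * (1 - z.1) → z.2 ≠ 0 → 1 - 2 * z.1 ≠ 0 →
        aeval z.1 q = 0 →
          aeval (((1 - 2 * z.1) + algebraMap ℚ L c * z.2 ^ (k + 2)) / (z.2 * (1 - 2 * z.1))) cT = 0) ∧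
      (∀ τ : L, aeval τ cT = 0 → ∃ z : L × L, z.2 ^ (2 * k + 1) = z.1 * (1 - z.1) ∧ z.2 ≠ 0 ∧
        1 - 2 * z.1 ≠ 0 ∧ aeval z.1 q = 0 ∧
          ((1 - 2 * z.1) + algebraMap ℚ L c * z.2 ^ (k + 2)) / (z.2 * (1 - 2 * z.1)) = τ) := by
  classical
  have hfin : Set.Finite {z : L × L | aeval z.1 q = 0 ∧ z.2 ^ (2 * k + 1) = z.1 * (1 - z.1) ∧
      z.2 ≠ 0 ∧ 1 - 2 * z.1 ≠ 0} :=
    (finite_pointsOver (L := L) k hq).subset fun z hz => ⟨hz.1, hz.2.1⟩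
  set S : Finset (L × L) := hfin.toFinset with hSdef
  let tv : L × L → L := fun z =>
    ((1 - 2 * z.1) + algebraMap ℚ L c * z.2 ^ (k + 2)) / (z.2 * (1 - 2 * z.1))
  have hint : ∀ x : L, IsIntegral ℚ x := fun x => Algebra.IsIntegral.isIntegral x
  -- the finite set of DISTINCT minimal polynomials of the values `t_c(z)`, `z ∈ S`
  set M : Finset ℚ[X] := S.image fun z => minpoly ℚ (tv z) with hMdef
  have hMirr : ∀ f ∈ M, Irreducible f ∧ f.Monic := by
    intro f hf
    rw [hMdef, Finset.mem_image] at hf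
    obtain ⟨z, _, rfl⟩ := hf
    exact ⟨minpoly.irreducible (hint _), minpoly.monic (hint _)⟩
  refine ⟨∏ f ∈ M, f, Polynomial.monic_prod_of_monic _ _ fun f hf => (hMirr f hf).2, ?_, ?_, ?_⟩
  · -- separable: distinct monic irreducibles are pairwise coprime, each separable (char 0)
    refine Polynomial.separable_prod' (fun f hf g hg hfg => ?_) fun f hf => (hMirr f hf).1.separable
    refine ((hMirr f hf).1.coprime_iff_not_dvd).mpr fun hdvd => hfg ?_
    exact Polynomial.eq_of_monic_of_associated (hMirr f hf).2 (hMirr g hg).2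
      ((hMirr f hf).1.associated_of_dvd (hMirr g hg).1 hdvd)
  · intro z hz hr hs hqz
    have hzS : z ∈ S := by
      rw [hSdef, Set.Finite.mem_toFinset]
      exact ⟨hqz, hz, hr, hs⟩
    have hmem : minpoly ℚ (tv z) ∈ M := by
      rw [hMdef, Finset.mem_image]
      exact ⟨z, hzS, rfl⟩
    obtain ⟨w, hw⟩ := Finset.dvd_prod_of_mem (fun f : ℚ[X] => f) hmem
    show aeval (tv z) (∏ f ∈ M, f) = 0
    rw [hw, map_mul, minpoly.aeval, zero_mul]
  · intro τ hτ
    rw [map_prod, Finset.prod_eq_zero_iff] at hτ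
    obtain ⟨f, hfM, hf0⟩ := hτ
    rw [hMdef, Finset.mem_image] at hfM
    obtain ⟨z, hzS, rfl⟩ := hfM
    rw [hSdef, Set.Finite.mem_toFinset] at hzS
    obtain ⟨hqz, hcurve, hr, hs⟩ := hzS
    have hconj : IsConjRoot ℚ (tv z) τ := isConjRoot_of_aeval_eq_zero (hint _) hf0
    obtain ⟨σ, hσ⟩ := isConjRoot_iff_exists_algEquiv.mp hconj
    let ρ : L →ₐ[ℚ] L := (σ.symm : L ≃ₐ[ℚ] L).toAlgHom
    have hρτ : ρ (tv z) = τ := by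
      change σ.symm (tv z) = τ
      rw [← hσ, AlgEquiv.symm_apply_apply]
    refine ⟨(ρ z.1, ρ z.2), map_onCurve ρ k hcurve, (map_nonpole ρ hr hs).1,
      (map_nonpole ρ hr hs).2, map_aeval_eq_zero ρ hqz, ?_⟩
    rw [← hρτ]
    exact (map_tval ρ k c z).symm

/-- **The separable pole polynomial, field-agnostic form** (`exists_polePoly_separable` with (a)
transported to the points over any field `F` over `ℚ` by `aeval_eq_zero_of_point`).
[cite: MochizukiGenEll2010, Thm 2.1 p.12] -/
theorem exists_polePoly_separable_anyField (L : Type*) [Field L] [Algebra ℚ L] [IsAlgClosure ℚ L]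
    (F : Type*) [Field F] [Algebra ℚ F] (k : ℕ) (c : ℚ) {q : ℚ[X]} (hq : q ≠ 0) :
    ∃ cT : ℚ[X], cT.Monic ∧ cT.Separable ∧
      (∀ w : F × F, w.2 ^ (2 * k + 1) = w.1 * (1 - w.1) → w.2 ≠ 0 → 1 - 2 * w.1 ≠ 0 →
        aeval w.1 q = 0 →
          aeval (((1 - 2 * w.1) + algebraMap ℚ F c * w.2 ^ (k + 2)) / (w.2 * (1 - 2 * w.1))) cT = 0) ∧
      (∀ z : L × L, z.2 ^ (2 * k + 1) = z.1 * (1 - z.1) → z.2 ≠ 0 → 1 - 2 * z.1 ≠ 0 →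
        aeval z.1 q = 0 →
          aeval (((1 - 2 * z.1) + algebraMap ℚ L c * z.2 ^ (k + 2)) / (z.2 * (1 - 2 * z.1))) cT = 0) ∧
      (∀ τ : L, aeval τ cT = 0 → ∃ z : L × L, z.2 ^ (2 * k + 1) = z.1 * (1 - z.1) ∧ z.2 ≠ 0 ∧
        1 - 2 * z.1 ≠ 0 ∧ aeval z.1 q = 0 ∧
          ((1 - 2 * z.1) + algebraMap ℚ L c * z.2 ^ (k + 2)) / (z.2 * (1 - 2 * z.1)) = τ) := by
  haveI : IsAlgClosed L := IsAlgClosure.isAlgClosed ℚ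
  obtain ⟨cT, hmon, hsep, ha, hb⟩ := exists_polePoly_separable (L := L) k c hq
  exact ⟨cT, hmon, hsep, fun w hw hr hs hqw => aeval_eq_zero_of_point k c hq cT ha w hw hr hs hqw,
    ha, hb⟩

end Separable

/-- **`hmT` from the protection theorem's output.** If at every root `γ` of `M` in an algebraically
closed field `Ω ⊇ ℚ` (e.g. `ℂ`) the values
of `P` and `Q` are nonzero and distinct (the conclusion of
`NoncriticalBelyi.exists_belyi_protecting_roots_of` / `exists_belyi_noncritical_protect`: the Belyi
map `P/Q` takes a value outside `{0, 1, ∞}` at the roots of `M`), then the bad-value polynomial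
`P·Q·(P − Q)` of the Belyi pair is COPRIME to `M` — the hypothesis `hmT` of
`isCoprime_of_rootSet_subset` with `m := P * Q * (P - Q)`, `cT := M`.
[cite: MochizukiGenEll2010, Thm 2.1 p.12] -/
theorem isCoprime_mul_mul_sub_of_forall_root {Ω : Type*} [Field Ω] [Algebra ℚ Ω] [IsAlgClosed Ω]
    {P Q M : ℚ[X]}
    (hval : ∀ γ : Ω, aeval γ M = 0 → aeval γ P ≠ 0 ∧ aeval γ Q ≠ 0 ∧ aeval γ P ≠ aeval γ Q) :
    IsCoprime (P * Q * (P - Q)) M := by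
  rw [Polynomial.isCoprime_iff_aeval_ne_zero_of_isAlgClosed ℚ Ω]
  intro γ
  by_contra h
  push Not at h
  obtain ⟨hm, hM⟩ := h
  obtain ⟨hP, hQ, hPQ⟩ := hval γ hM
  rw [map_mul, map_mul, map_sub] at hm
  rcases mul_eq_zero.mp hm with h | h
  · rcases mul_eq_zero.mp h with h | h
    · exact hP h
    · exact hQ h
  · exact hPQ (sub_eq_zero.mp h)

end ConfigurationProtection

end Literature.NumberTheory.DiophantineGeometry.GenEll

end
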